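import Summits.BirchSwinnertonDyer.BirchSwinnertonDyer.Theorems.ByReductionTypeAtTwoRankOneAtTwoOneDoorLawDefs
import HarnessLib

/-!
# Route ByReductionTypeAtTwo, crux `RankOneAtTwoBigImageOddLocal` (stmt-BirchSwinnertonDyer-23715), LINE v8.4 `one_door_analytic`:
# the ONE DOOR LAW with the PARAMETRISATION CONSTANT floating (`DoorIndexLawFullCAtTwo`, AN-28c) — the Manin-free reshape

Lead prover seat `bsd-line-fkl-p1` g7 (2026-08-28).  Companion of `…OneDoorLawDefs.lean` (395 lines; this is its APPEND #5 as a
separate module, same namespace, so that the statements file stays under the size limit).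

Why.  The line of record v8.3 (`Cruxes/RankOneAtTwoBigImageOddLocal/Lines/one_door_analytic.lean`) states its load-bearing law
`DoorIndexLawFullAtTwo` (AN-28, APPEND #3) for parametrisation data `Dt` with ODD constant `c`, and therefore needs a stub
producing such a datum: `S_manin` = PRINT at `4 ∤ N` (Abbes–Ullmo 1996, Česnavičius 2018) + the OPEN `2`-primary Manin
conjecture at additive level (`@[conjecture] ManinOddAdditiveLevelAtTwo`, APPEND #4).  Two observations of this generation:

1. REF2's suggested partial discharge of `ManinOddAdditiveLevelAtTwo` by Česnavičius–Neururer–Saha 2024 Thm. 1.2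
   (`val₂ c_φ ≤ val₂ deg φ`, tree fact `cesnaviciusNeururerSaha_padicVal_maninConstant_le_modularDegree`) on the odd-modular-degree
   sub-slice is VACUOUS on this crux: by Calegari–Emerton 2009, Thm. 1, a curve of odd modular degree has EVEN analytic rank,
   and every parametrisation `X₀(N) ↠ E` factors through the optimal quotient (same analytic rank), so on the analytic-rank-`1`
   slice every datum has even degree.
2. The constant is NOT an input of `BSD₂` at all.  The tree door `P2.bsdp_two_iff_of_heegner_rankOne` reads
   `BSD(E,2) ⟺ ord₂(8 I² t_W² / (n k² t_K² c² w² q_d |u| c_W)) = ord₂ #Ш(E)` for ANY datum (`c ≠ 0` is a tree theorem); a datum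
   with `φ_D = n·φ₁` has `c_D = n·c₁` and Heegner point `n·P₁`, so `2m − 2v₂(c)` is datum-free.  Carrying `2·v₂(c)` in the
   law (below) instead of fixing an odd-`c` datum makes the law apply to EVERY datum, and the glue then needs only the EXISTENCE of
   a datum at level `N_E` — modularity plus an integral Néron multiplier (`…OneDoorManin.lean`'s construction without its
   Abbes–Ullmo/Česnavičius step).  `stub_maninPub` and `stub_maninAdditive` leave the cone; stubs 6 → 4.

The per-datum equivalence with `BSD₂` is `bsdp_two_iff_doorLawFullC_at` (`Theorems/…OneDoorFullC.lean`, this generation); the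
glue and the crux-by-name assembly over this law are `Theorems/…OneDoorAnalyticAssemblyC.lean`.  Relation to AN-28: on odd-`c`
data the two identities coincide (`padicValInt.eq_zero_of_not_dvd`), so `DoorIndexLawFullCAtTwo → DoorIndexLawFullAtTwo`
(`doorIndexLawFullAtTwo_of_doorIndexLawFullCAtTwo` below) and every ENGINE-L census row of AN-28 (optimal curves, `c = 1`,
kit j300076 597/597) is a row of AN-28c with the same verdict; conversely AN-28 + an odd-`c` datum gives `BSD₂(W)` and hence
AN-28c at every datum of `W` (both directions modulo PRINT + rank-`0` `BSD₂` of the twin, by the two kernel iffs).  The law is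
exactly as plausible as `BSD₂` on the slice — it IS `BSD₂` on the slice in Heegner-index currency (REF1 §85: lossless
reformulation).  Nothing is asserted; BSD is not proved by any of this.

References (locators): Gross–Zagier 1986 Thm. I.6.3 and V.§2 (the `c²` in (2.2)); Gross 1991 Conj. 1.2 and §3; Kramer 1981
Thm. 1 and Prop. 3; Calegari–Emerton, Israel J. Math. 169 (2009), Thm. 1; Česnavičius–Neururer–Saha, JEMS 26 (2024), Thm. 1.2.
-/

set_option autoImplicit false

noncomputable section

open scoped Classical

set_option linter.dupNamespace false

namespace Summit.BirchSwinnertonDyer.BirchSwinnertonDyer.Theorems.RankOneAtTwoOneDoor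

open Literature.NumberTheory.EllipticCurves Literature.NumberTheory.EllipticCurves.ModularForms
  Summit.BirchSwinnertonDyer.Rank1Residual.F1Sign2
  Summit.BirchSwinnertonDyer.Rank1Residual.F1Sign2.TranspositionDoor

/-- **AN-28c `DoorIndexLawFullCAtTwo` — the ONE DOOR LAW with the twin's `Ш` AND the parametrisation constant floating
(CONJECTURE; LOAD-BEARING stub of LINE v8.4; the Manin-free form of AN-28 `DoorIndexLawFullAtTwo`).**
`W` globally minimal, non-CM, `ρ_{W,2^n}` onto for all `n`, odd torsion, odd Tamagawa product, analytic rank one; `K` imaginary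
quadratic with `d_K` door-admissible and `L(W^{(d_K)},1) ≠ 0`; ANY parametrisation datum `Dt` of level `N_W` (constant
`c = Dt.c ≠ 0`, no parity assumed) with `P ∈ E(K)` mapping to its complex Heegner point; `Wd` a globally minimal model of
`W^{(d_K)}`.  THEN `P` has an exact `2`-divisibility exponent `m` modulo torsion and
`2m + [Δ_W < 0] = ord₂ #Ш(W)[2^∞] + ord₂ #Ш(Wd)[2^∞] + t + 2s + 2·v₂(c)`.
This is VERBATIM the right-hand side of the per-datum kernel iff `bsdp_two_iff_doorLawFullC_at` (`Theorems/…OneDoorFullC.lean`):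
modulo GZ/Kolyvagin/GZK/modularity + `BSDp Wd 2` + the proved twist Tamagawa arithmetic, `BSDp W 2 ↔` (this conclusion) — for
every datum, so no odd-constant datum (no Manin-constant input) is needed to read `BSD₂(W)` off it.  At `2 ∤ c` it is AN-28's
identity.  Why it might fail: it is the joint `2`-part of BSD of the door pair modulo rank-`0` `BSD₂(E^{(d)})`, exactly as AN-28.
Census: = AN-28's (ENGINE L j300076 P27.1, 597/597 rows, all with optimal parametrisations of constant `1`).
[cite: GrossZagier1986, Thm. I.6.3 and V.§2] [cite: GrossLMS1991, Conj. 1.2 and §3] [cite: Kramer1981, Thm. 1 and Prop. 3] -/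
@[conjecture] def DoorIndexLawFullCAtTwo : Prop :=
  ∀ (W : WeierstrassCurve ℚ) [W.IsElliptic] [W.IsGloballyMinimal] [NeZero (W.conductorNorm ℤ)],
    ¬ W.HasCM → (∀ n : ℕ, W.HasSurjectiveModNGaloisRep ((2 ^ n : ℕ) : ℤ)) → Odd W.torsionOrder → Odd W.tamagawaProduct →
    W.analyticRank = 1 →
    ∀ (K : Type) [Field K] [NumberField K], IsImaginaryQuadratic K →
      DoorAdmissible W (NumberField.discr K) →
      (W.quadraticTwist (NumberField.discr K : ℚ)).entireLFunction 1 ≠ 0 →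
      ∀ (Dt : ModularParametrizationData W (W.conductorNorm ℤ))
        (H : HeegnerDatum (W.conductorNorm ℤ) (NumberField.discr K)) (ι : K →+* ℂ)
        (P : (W.baseChange K).toAffine.Point),
        WeierstrassCurve.Affine.Point.map ι.toRatAlgHom P = heegnerPointComplex Dt H →
        ∀ (Wd : WeierstrassCurve ℚ) [Wd.IsElliptic] [Wd.IsGloballyMinimal] (Cd : WeierstrassCurve.VariableChange ℚ),
          Cd • W.quadraticTwist (NumberField.discr K : ℚ) = Wd →
          ∃ m : ℕ, HasTwoDivisibilityUpToTorsion W K P m ∧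
            2 * m + (if W.Δ < 0 then 1 else 0) =
              padicValNat 2 (Nat.card (AddCommGroup.primaryComponent W.sha 2)) +
                padicValNat 2 (Nat.card (AddCommGroup.primaryComponent Wd.sha 2)) +
                transpCount W (NumberField.discr K) + 2 * identCount W (NumberField.discr K) +
                2 * padicValInt 2 Dt.c

/-- **AN-28c ⇒ AN-28**: at a datum with odd constant the correction `2·v₂(c)` vanishes, so the floating-constant law specialises
to `DoorIndexLawFullAtTwo` verbatim. -/
theorem doorIndexLawFullAtTwo_of_doorIndexLawFullCAtTwo (h : DoorIndexLawFullCAtTwo) : DoorIndexLawFullAtTwo := by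
  intro W _ _ _ hCM hsurj hT hc hr K _ _ hK hadm hLt Dt H ι P hP hcodd Wd _ _ Cd hWd
  obtain ⟨m, hm, hlaw⟩ := h W hCM hsurj hT hc hr K hK hadm hLt Dt H ι P hP Wd Cd hWd
  refine ⟨m, hm, ?_⟩
  rw [padicValInt.eq_zero_of_not_dvd hcodd, mul_zero, add_zero] at hlaw
  exact hlaw

/-! ### APPEND #6 (lead prover seat `bsd-line-fkl-p1` g8, 2026-08-28) — LINE v8.6: the ONE DOOR LAW SPLIT INTO ITS TWO HALVES

AN-28c `DoorIndexLawFullCAtTwo` is an IDENTITY between the index side `2m + [Δ_W < 0]` and the `Ш` side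
`s_E + s_d + t + 2s + 2·v₂(c)` at every non-vanishing door datum.  By the width seat's `doorValuationC_at`
(`Theorems/…OneDoorValuation.lean`: `ord₂ #Ш_an(W) = 2m + [Δ_W<0] − s_d − t − 2s − 2·v₂(c)` modulo print and `BSD₂` of the twin) each
INEQUALITY between the two sides is one half of `BSD₂(W)` in Miller's currency: `Ш`-side `≤` index-side is
`Typed.MissingUpperBoundAt W 2` (`ord₂ #Ш(W) ≤ ord₂ #Ш_an(W)`, the EULER-SYSTEM half — Kolyvagin's bound made exact at `2`), and
index-side `≤` `Ш`-side is `Typed.MissingLowerBoundAt W 2` (`ord₂ #Ш_an(W) ≤ ord₂ #Ш(W)`, the CONVERSE half — Kolyvagin's conjecture /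
main-conjecture direction at `2`).  The two halves are stated below for EVERY exponent `m` of the Heegner point (in rank one the exponent
exists and is unique modulo print: `exists_twoDivisibility_of_rankOne`, `hasTwoDivisibilityUpToTorsion_unique`), with AN-28c's binders
VERBATIM; `doorIndexLaw_eq_of_halves` is the import-free half of «AN-28c ⟺ UPPER ∧ LOWER» (the other needs the exponent's existence and
uniqueness, i.e. Gross–Zagier + Kolyvagin + modularity: `Theorems/…OneDoorHalvesAssembly.lean`).  Purpose: the line's one open conjecture
splits along the classical Euler-system / converse divide, half by half parallel to route GenusKolyvaginAtTwo's K-side stubs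
`stub_upperBoundAtTwo` / `stub_lowerBoundAtTwo` of `KolyvaginExactAtTwo` (stmt-22137).  Census of each half = AN-28c's (every certified row
of an identity is a row of both inequalities).  Nothing is asserted; BSD is not proved by any of this. -/

/-- **AN-28c-U `DoorIndexLawUpperCAtTwo` — the EULER-SYSTEM HALF of the one door law (CONJECTURE): the `Ш` side is AT MOST the index
side.**  Binders verbatim as in `DoorIndexLawFullCAtTwo` (`W` globally minimal, non-CM, `ρ_{W,2^n}` onto for all `n`, odd torsion, odd
Tamagawa product, analytic rank one; `K` imaginary quadratic with `d_K` door-admissible and `L(W^{(d_K)},1) ≠ 0`; ANY parametrisation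
datum `Dt` of level `N_W` with `P ∈ E(K)` mapping to its complex Heegner point; `Wd` a globally minimal model of `W^{(d_K)}`).  THEN for
every exact `2`-divisibility exponent `m` of `P` modulo torsion,
`ord₂ #Ш(W)[2^∞] + ord₂ #Ш(Wd)[2^∞] + t + 2s + 2·v₂(c) ≤ 2m + [Δ_W < 0]`.
Reading: modulo Gross–Zagier / Kolyvagin / modularity and `BSD₂(Wd)` this is `ord₂ #Ш(W) ≤ ord₂ #Ш_an(W)` (`Typed.MissingUpperBoundAt W 2`,
via `doorValuationC_at`), i.e. the UPPER BOUND on `Ш(W)[2^∞]` by the `2`-part of the Heegner index — Kolyvagin's theorem with the exact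
power of `2`, printed for odd `p` with surjective `ρ_{E,p}` only (Kolyvagin 1990; Gross 1991 §§3–5 «`p` odd»).  Why it might fail: an
unaccounted `2` in the Euler-system bound at `p = 2` (complex conjugation acts unipotently on `E[2]` when `Δ_W < 0`; no eigenspace
decomposition modulo `2`).  Census: = AN-28c's (ENGINE L j300076 + j303912, 1020/1020 rows).
[cite: Kolyvagin1990, Thm. A] [cite: GrossLMS1991, Conj. 1.2 and §3] [cite: GrossZagier1986, Thm. I.6.3 and V.§2] -/
@[conjecture] def DoorIndexLawUpperCAtTwo : Prop :=
  ∀ (W : WeierstrassCurve ℚ) [W.IsElliptic] [W.IsGloballyMinimal] [NeZero (W.conductorNorm ℤ)],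
    ¬ W.HasCM → (∀ n : ℕ, W.HasSurjectiveModNGaloisRep ((2 ^ n : ℕ) : ℤ)) → Odd W.torsionOrder → Odd W.tamagawaProduct →
    W.analyticRank = 1 →
    ∀ (K : Type) [Field K] [NumberField K], IsImaginaryQuadratic K →
      DoorAdmissible W (NumberField.discr K) →
      (W.quadraticTwist (NumberField.discr K : ℚ)).entireLFunction 1 ≠ 0 →
      ∀ (Dt : ModularParametrizationData W (W.conductorNorm ℤ))
        (H : HeegnerDatum (W.conductorNorm ℤ) (NumberField.discr K)) (ι : K →+* ℂ)
        (P : (W.baseChange K).toAffine.Point),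
        WeierstrassCurve.Affine.Point.map ι.toRatAlgHom P = heegnerPointComplex Dt H →
        ∀ (Wd : WeierstrassCurve ℚ) [Wd.IsElliptic] [Wd.IsGloballyMinimal] (Cd : WeierstrassCurve.VariableChange ℚ),
          Cd • W.quadraticTwist (NumberField.discr K : ℚ) = Wd →
          ∀ m : ℕ, HasTwoDivisibilityUpToTorsion W K P m →
            padicValNat 2 (Nat.card (AddCommGroup.primaryComponent W.sha 2)) +
                padicValNat 2 (Nat.card (AddCommGroup.primaryComponent Wd.sha 2)) +
                transpCount W (NumberField.discr K) + 2 * identCount W (NumberField.discr K) +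
                2 * padicValInt 2 Dt.c ≤
              2 * m + (if W.Δ < 0 then 1 else 0)

/-- **AN-28c-L `DoorIndexLawLowerCAtTwo` — the CONVERSE HALF of the one door law (CONJECTURE): the index side is AT MOST the `Ш`
side.**  Binders verbatim as in `DoorIndexLawFullCAtTwo`.  THEN for every exact `2`-divisibility exponent `m` of `P` modulo torsion,
`2m + [Δ_W < 0] ≤ ord₂ #Ш(W)[2^∞] + ord₂ #Ш(Wd)[2^∞] + t + 2s + 2·v₂(c)`.
Reading: modulo Gross–Zagier / Kolyvagin / modularity and `BSD₂(Wd)` this is `ord₂ #Ш_an(W) ≤ ord₂ #Ш(W)` (`Typed.MissingLowerBoundAt W 2`,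
via `doorValuationC_at`), i.e. the Heegner index is NO MORE divisible by `2` than `Ш(W)[2^∞]·Ш(Wd)[2^∞]` and the door's local terms
account for — the direction of Kolyvagin's conjecture / the rank-one `p`-converse (W. Zhang 2014, `p ≥ 5`) and of the main-conjecture
lower bound (Jetchev–Skinner–Wan 2017, `p` odd), with no printed instance at `p = 2` for non-CM curves.  Why it might fail: extra
`2`-divisibility of the Heegner point not visible in `Ш[2^∞]` (e.g. from genus theory of `K` beyond the door's `t + 2s`).
Census: = AN-28c's (ENGINE L j300076 + j303912, 1020/1020 rows).
[cite: GrossLMS1991, Conj. 1.2 and §3] [cite: Zhang2014, Thm. 1.1] [cite: JetchevSkinnerWan2017, Thm. 1.2.1 and §7.4.1] -/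
@[conjecture] def DoorIndexLawLowerCAtTwo : Prop :=
  ∀ (W : WeierstrassCurve ℚ) [W.IsElliptic] [W.IsGloballyMinimal] [NeZero (W.conductorNorm ℤ)],
    ¬ W.HasCM → (∀ n : ℕ, W.HasSurjectiveModNGaloisRep ((2 ^ n : ℕ) : ℤ)) → Odd W.torsionOrder → Odd W.tamagawaProduct →
    W.analyticRank = 1 →
    ∀ (K : Type) [Field K] [NumberField K], IsImaginaryQuadratic K →
      DoorAdmissible W (NumberField.discr K) →
      (W.quadraticTwist (NumberField.discr K : ℚ)).entireLFunction 1 ≠ 0 →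
      ∀ (Dt : ModularParametrizationData W (W.conductorNorm ℤ))
        (H : HeegnerDatum (W.conductorNorm ℤ) (NumberField.discr K)) (ι : K →+* ℂ)
        (P : (W.baseChange K).toAffine.Point),
        WeierstrassCurve.Affine.Point.map ι.toRatAlgHom P = heegnerPointComplex Dt H →
        ∀ (Wd : WeierstrassCurve ℚ) [Wd.IsElliptic] [Wd.IsGloballyMinimal] (Cd : WeierstrassCurve.VariableChange ℚ),
          Cd • W.quadraticTwist (NumberField.discr K : ℚ) = Wd →
          ∀ m : ℕ, HasTwoDivisibilityUpToTorsion W K P m →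
            2 * m + (if W.Δ < 0 then 1 else 0) ≤
              padicValNat 2 (Nat.card (AddCommGroup.primaryComponent W.sha 2)) +
                padicValNat 2 (Nat.card (AddCommGroup.primaryComponent Wd.sha 2)) +
                transpCount W (NumberField.discr K) + 2 * identCount W (NumberField.discr K) +
                2 * padicValInt 2 Dt.c

/-- **The two halves give AN-28c's identity at every exponent** (import-free bookkeeping: `le_antisymm`).  The remaining step to
AN-28c itself — that an exponent EXISTS at every door datum of the slice — is Gross–Zagier + Kolyvagin + modularity
(`Theorems/…OneDoorHalvesAssembly.lean`). -/
theorem doorIndexLaw_eq_of_halves (hU : DoorIndexLawUpperCAtTwo) (hL : DoorIndexLawLowerCAtTwo)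
    (W : WeierstrassCurve ℚ) [W.IsElliptic] [W.IsGloballyMinimal] [NeZero (W.conductorNorm ℤ)]
    (hCM : ¬ W.HasCM) (hsurj : ∀ n : ℕ, W.HasSurjectiveModNGaloisRep ((2 ^ n : ℕ) : ℤ)) (hT : Odd W.torsionOrder)
    (hc : Odd W.tamagawaProduct) (hr : W.analyticRank = 1)
    (K : Type) [Field K] [NumberField K] (hK : IsImaginaryQuadratic K) (hadm : DoorAdmissible W (NumberField.discr K))
    (hLt : (W.quadraticTwist (NumberField.discr K : ℚ)).entireLFunction 1 ≠ 0)
    (Dt : ModularParametrizationData W (W.conductorNorm ℤ)) (H : HeegnerDatum (W.conductorNorm ℤ) (NumberField.discr K))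
    (ι : K →+* ℂ) (P : (W.baseChange K).toAffine.Point)
    (hP : WeierstrassCurve.Affine.Point.map ι.toRatAlgHom P = heegnerPointComplex Dt H)
    (Wd : WeierstrassCurve ℚ) [Wd.IsElliptic] [Wd.IsGloballyMinimal] (Cd : WeierstrassCurve.VariableChange ℚ)
    (hWd : Cd • W.quadraticTwist (NumberField.discr K : ℚ) = Wd) (m : ℕ) (hm : HasTwoDivisibilityUpToTorsion W K P m) :
    2 * m + (if W.Δ < 0 then 1 else 0) =
      padicValNat 2 (Nat.card (AddCommGroup.primaryComponent W.sha 2)) +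
        padicValNat 2 (Nat.card (AddCommGroup.primaryComponent Wd.sha 2)) +
        transpCount W (NumberField.discr K) + 2 * identCount W (NumberField.discr K) +
        2 * padicValInt 2 Dt.c :=
  le_antisymm (hL W hCM hsurj hT hc hr K hK hadm hLt Dt H ι P hP Wd Cd hWd m hm)
    (hU W hCM hsurj hT hc hr K hK hadm hLt Dt H ι P hP Wd Cd hWd m hm)

/-- **AN-28c ⇒ its lower half at AN-28c's own exponent, and its upper half wherever the exponent is unique**: if every exponent of
`P` equals a given one (rank one: `hasTwoDivisibilityUpToTorsion_unique`), the identity gives both inequalities.  Import-free form; the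
uniqueness is discharged modulo print in `Theorems/…OneDoorHalvesAssembly.lean`. -/
theorem halves_of_doorIndexLawFullCAtTwo_of_unique (h : DoorIndexLawFullCAtTwo)
    (W : WeierstrassCurve ℚ) [W.IsElliptic] [W.IsGloballyMinimal] [NeZero (W.conductorNorm ℤ)]
    (hCM : ¬ W.HasCM) (hsurj : ∀ n : ℕ, W.HasSurjectiveModNGaloisRep ((2 ^ n : ℕ) : ℤ)) (hT : Odd W.torsionOrder)
    (hc : Odd W.tamagawaProduct) (hr : W.analyticRank = 1)
    (K : Type) [Field K] [NumberField K] (hK : IsImaginaryQuadratic K) (hadm : DoorAdmissible W (NumberField.discr K))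
    (hLt : (W.quadraticTwist (NumberField.discr K : ℚ)).entireLFunction 1 ≠ 0)
    (Dt : ModularParametrizationData W (W.conductorNorm ℤ)) (H : HeegnerDatum (W.conductorNorm ℤ) (NumberField.discr K))
    (ι : K →+* ℂ) (P : (W.baseChange K).toAffine.Point)
    (hP : WeierstrassCurve.Affine.Point.map ι.toRatAlgHom P = heegnerPointComplex Dt H)
    (Wd : WeierstrassCurve ℚ) [Wd.IsElliptic] [Wd.IsGloballyMinimal] (Cd : WeierstrassCurve.VariableChange ℚ)
    (hWd : Cd • W.quadraticTwist (NumberField.discr K : ℚ) = Wd)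
    (huniq : ∀ m m' : ℕ, HasTwoDivisibilityUpToTorsion W K P m → HasTwoDivisibilityUpToTorsion W K P m' → m = m')
    (m : ℕ) (hm : HasTwoDivisibilityUpToTorsion W K P m) :
    padicValNat 2 (Nat.card (AddCommGroup.primaryComponent W.sha 2)) +
          padicValNat 2 (Nat.card (AddCommGroup.primaryComponent Wd.sha 2)) +
          transpCount W (NumberField.discr K) + 2 * identCount W (NumberField.discr K) +
          2 * padicValInt 2 Dt.c ≤ 2 * m + (if W.Δ < 0 then 1 else 0) ∧
      2 * m + (if W.Δ < 0 then 1 else 0) ≤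
        padicValNat 2 (Nat.card (AddCommGroup.primaryComponent W.sha 2)) +
          padicValNat 2 (Nat.card (AddCommGroup.primaryComponent Wd.sha 2)) +
          transpCount W (NumberField.discr K) + 2 * identCount W (NumberField.discr K) +
          2 * padicValInt 2 Dt.c := by
  obtain ⟨m₀, hm₀, hlaw⟩ := h W hCM hsurj hT hc hr K hK hadm hLt Dt H ι P hP Wd Cd hWd
  obtain rfl : m₀ = m := huniq m₀ m hm₀ hm
  exact ⟨hlaw.ge, hlaw.le⟩

end Summit.BirchSwinnertonDyer.BirchSwinnertonDyer.Theorems.RankOneAtTwoOneDoor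

end
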